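import Literature.Computability.Cryptography.UOWHFTreeHashSecurity
import Literature.Computability.Cryptography.InaccessibleEntropyUOWHFCompose
import HarnessLib

/-!
# One-way functions give tree-hashing UOWHFs on all input lengths (Goldreich 2004, Thm. 6.4.29 via Steps I–IV)

Topic `Literature/Computability/Cryptography`. Instantiates the tree hashing of `UOWHFTreeHash*.lean` (Goldreich's Steps
III–IV, Props. 6.4.25/6.4.27) at the leveled factor-two restricted UOWHF `HHRVW.compose2 p f`
(`InaccessibleEntropyUOWHFCompose.lean`: Steps I–II over the inaccessible-entropy UOWHF of Haitner et al.): `tspec2 p f : TSpec`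
(halving brick `MDCompose.hashC (spec2 p f)`, coins `Pd·p`, half-block `m = d − 1`, `L(n) = n` levels, tree coins
`X·(Pd·p)`), its well-formedness `tspec2_wf`, `base_tspec2 : TreeHash.base (tspec2 p f) = compose2 p f`, and the tree
collection `treeHash2 p f := TreeHash.treeHash (tspec2 p f)` with `tcr_treeHash2`: for a one-way length-preserving `f ∈ FP`,
`treeHash2 p f` is efficient, has the range `rLenT` on ALL inputs, and every two-stage PPT adversary forms designated
collisions (unrestricted, Def. 6.4.18) with negligible probability; `exists_tcr_treeHash_of_OWFExist` packages it with the index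
facts (`|s| = M_{pT}(n)` on the support, coin budget `pT`). What remains of Def. 6.4.18 is the renormalisation `|s| = n`
(a separate file). All proved; no named facts.

## References

* O. Goldreich, *Foundations of Cryptography II*, CUP 2004, §6.4.3, Thm. 6.4.29, Props. 6.4.25, 6.4.27, Constr. 6.4.26.
* I. Haitner, T. Holenstein, O. Reingold, S. Vadhan, H. Wee, *Inaccessible entropy II*, Theory of Computing 16 (2020), Thm. 5.1.
-/

namespace Literature.Computability.Cryptography

namespace HHRVW

open _root_.Computability Complexity Complexity.Brick Complexity.Plumb Polynomial Filter Asymptotics Sz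
open TreeHash (TSpec treeHash rLenT)

variable (p : Polynomial ℕ) (f : List Bool → List Bool)

/-- The unary brick of the half-block length `m = d − 1`. [folklore] -/
noncomputable def mFd : List Bool → List Bool := dropFn ∘ fanoutFn (fun _ => [true]) dLFd

/-- Value of `mFd`. [folklore] -/
theorem mFd_apply (n : ℕ) : mFd (ones n) = ones (d n - 1) := by
  rw [mFd, Function.comp_apply, fanoutFn_apply, compile_d_apply, dropFn_boolPair]
  simp [ones]

/-- `mFd ∈ FP`. [folklore] -/
theorem mFd_mem_FP : mFd ∈ FP := comp_mem_FP dropFn_mem_FP (fanoutFn_mem_FP (const_mem_FP _) (UExpr.compile₁_mem_FP _))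

/-- **The tree specification over `compose2 p f`**: halving brick `hashC (spec2 p f)` (`{0,1}^{2(d−1)} → {0,1}^{d−1}` at
level `n`), basic coins `Pd·p`, `m = d − 1`, `L(n) = n` levels, bounds `Pd`, `X`, tree coins `X·(Pd·p)`.
[cite: Goldreich2004, Construction 6.4.26 over Prop. 6.4.23's family] -/
noncomputable def tspec2 : TSpec where
  hb := MDCompose.hashC (spec2 p f)
  P := Pd * p
  m := fun n => d n - 1
  L := fun n => n
  mF := mFd
  LF := id
  Pm := Pd
  PL := Polynomial.X
  pT := Polynomial.X * (Pd * p)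

/-- The basic family of the tree specification is `compose2`. [folklore] -/
theorem base_tspec2 : TreeHash.base (tspec2 p f) = compose2 p f := rfl

/-! Projections of `tspec2` (by `rw`: `rfl`/unification on some fields of this structure exhausts the recursion depth). -/

/-- Projection. [folklore] -/
theorem tspec2_hb : (tspec2 p f).hb = MDCompose.hashC (spec2 p f) := by rw [tspec2]
/-- Projection. [folklore] -/
theorem tspec2_P : (tspec2 p f).P = Pd * p := by rw [tspec2]
/-- Projection. [folklore] -/
theorem tspec2_m : (tspec2 p f).m = fun n => d n - 1 := by rw [tspec2]
/-- Projection. [folklore] -/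
theorem tspec2_L : (tspec2 p f).L = fun n => n := by rw [tspec2]
/-- Projection. [folklore] -/
theorem tspec2_mF : (tspec2 p f).mF = mFd := by rw [tspec2]
/-- Projection. [folklore] -/
theorem tspec2_LF : (tspec2 p f).LF = id := by rw [tspec2]
/-- Projection. [folklore] -/
theorem tspec2_Pm : (tspec2 p f).Pm = Pd := by rw [tspec2]
/-- Projection. [folklore] -/
theorem tspec2_PL : (tspec2 p f).PL = Polynomial.X := by rw [tspec2]
/-- Projection. [folklore] -/
theorem tspec2_pT : (tspec2 p f).pT = Polynomial.X * (Pd * p) := by rw [tspec2]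

variable {p f}

/-- **Well-formedness of `tspec2 p f`** for `f ∈ FP` and `p ≥ K`. [cite: Goldreich2004, Construction 6.4.26 ("tedious details")] -/
theorem tspec2_wf (hf : f ∈ FP) (hK : ∀ n, K n ≤ p.eval n) : (tspec2 p f).WF := by
  have hS := spec2_wf (p := p) hf hK
  constructor
  · rw [tspec2_hb]; exact MDCompose.hashC_mem_FP _ hS
  · intro n; rw [tspec2_mF, tspec2_m]; exact mFd_apply n
  · intro n; rw [tspec2_LF, tspec2_L]; rfl
  · rw [tspec2_mF]; exact mFd_mem_FP
  · rw [tspec2_LF]; exact PolyTimeComputable.id _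
  · intro n; rw [tspec2_m, tspec2_Pm]; exact (Nat.sub_le _ _).trans (d_le_Pd n)
  · intro n; rw [tspec2_L, tspec2_PL, eval_X]
  · intro n; rw [tspec2_L, tspec2_P, tspec2_pT]; dsimp only; simp only [eval_mul, eval_X, le_refl]
  · intro n; rw [tspec2_m]; have := two_le_d n; dsimp only; omega
  · intro n r x hr _
    rw [tspec2_P] at hr
    rw [tspec2_hb, tspec2_m]
    dsimp only
    rw [MDCompose.length_hashC _ hS, spec2_dL, spec2_p₂, MDCompose.nOf_length_idx (Pd * p) n hr]

variable (p f)

/-- **The tree UOWHF family over a one-way function**. [cite: Goldreich2004, Thm. 6.4.29 (Steps I–IV)] -/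
noncomputable def treeHash2 : HashCollection := treeHash (tspec2 p f)

variable {p f}

/-- The domain of `compose2` at a basic index of level `n` is two half-blocks. [folklore] -/
theorem dLen2_M (n : ℕ) : dLen2 p f (LenPres.M (Pd * p) n) = 2 * (d n - 1) := by
  rw [dLen2_eq, rLen2_eq, LenPres.nOf_eq le_rfl (LenPres.M_strictMono (Nat.lt_succ_self n))]

/-- **OWF ⇒ the tree family is target-collision resistant on all inputs** (Goldreich's Thm. 6.4.29 minus the index
renormalisation): efficient, range `rLenT` everywhere, negligible designated-collision probability for every two-stage PPT
adversary. [cite: Goldreich2004, Thm. 6.4.29 via Props. 6.4.21, 6.4.23, 6.4.25, 6.4.27; HaitnerEtAl2020, Thm. 5.1] -/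
theorem tcr_treeHash2 (hf : IsOneWay f) (hlp : IsLengthPreserving f) (hK : ∀ n, K n ≤ p.eval n) :
    (treeHash2 p f).IsEfficient ∧ (treeHash2 p f).HasRange (rLenT (tspec2 p f)) ∧
      ∀ q : Polynomial ℕ, ∀ A₀ : List Bool → List Bool, A₀ ∈ FP → ∀ A : RandAlg (List Bool) (List Bool), IsPPT A id →
        SuperpolynomialDecay atTop (fun n : ℕ => (n : ℝ)) ((treeHash2 p f).tcrProb (fun m => q.eval m) A₀ A) :=
  TreeHash.tcr_treeHash (tspec2_wf hf.1 hK) (fun _ => le_rfl) (dB := dLen2 p f) (rB := rLen2 p f) (fun n => dLen2_M n)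
    (by rw [base_tspec2]; exact isLeveledRUOWHF_compose2 hf hlp hK)

/-- Indices of `treeHash2 p f` at parameter `n` have length `M_{X·Pd·p}(n)`. [cite: Goldreich2004, Def. 6.4.18 (1)] -/
theorem length_index_treeHash2 {n : ℕ} {s : List Bool} (hs : s ∈ ((treeHash2 p f).indexPMF n).support) :
    s.length = LenPres.M (Polynomial.X * (Pd * p)) n :=
  TreeHash.length_index_treeHash hs

/-- **Existence form**: one-way functions give hash collections with `p`-shaped indices that are efficient, have a range
length depending only on `|s|` on ALL inputs, and negligible (unrestricted) designated-collision probability against every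
two-stage PPT adversary. [cite: Goldreich2004, Thm. 6.4.29] -/
theorem exists_tcr_treeHash_of_OWFExist (h : OWFExist) :
    ∃ (H : HashCollection) (rL : ℕ → ℕ) (P : Polynomial ℕ), H.IsEfficient ∧ H.HasRange rL ∧
      (∀ q : Polynomial ℕ, ∀ A₀ : List Bool → List Bool, A₀ ∈ FP → ∀ A : RandAlg (List Bool) (List Bool), IsPPT A id →
        SuperpolynomialDecay atTop (fun n : ℕ => (n : ℝ)) (H.tcrProb (fun m => q.eval m) A₀ A)) ∧
      (∀ n, ∀ s ∈ (H.indexPMF n).support, s.length = LenPres.M P n) ∧ (∀ L, H.index.coinLen L = P.eval L) := by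
  obtain ⟨f, hf, hlp⟩ := h.exists_isLengthPreserving
  obtain ⟨p, hp⟩ := UExpr.exists_poly_le₁ E.K
  have hK : ∀ n, K n ≤ p.eval n := fun n => by have h := hp n; simp only [E.K_eval] at h; exact h
  obtain ⟨h1, h2, h3⟩ := tcr_treeHash2 hf hlp hK
  exact ⟨treeHash2 p f, rLenT (tspec2 p f), Polynomial.X * (Pd * p), h1, h2, h3, fun n s hs => length_index_treeHash2 hs, fun L => rfl⟩

/-! ### Admissible indexing and Theorem 6.4.29 -/

/-- **`p`-shaped indexing is admissible** (Def. 6.4.18 (1)): if every index in the range of `I(1ⁿ)` has length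
`M_P(n) = P(n) + n + 1`, then `n ≤ |s|` and `1ⁿ` is computed from `s` in polynomial time (`LenPres.nOfFn`).
[cite: Goldreich2004, Def. 6.4.18 (1)] -/
theorem isAdmissible_of_length_index {H : HashCollection} {P : Polynomial ℕ}
    (hlen : ∀ n, ∀ s ∈ (H.indexPMF n).support, s.length = LenPres.M P n) : H.IsAdmissible := by
  refine ⟨⟨Polynomial.X, Filter.Eventually.of_forall fun n s hs => ?_⟩,
    ⟨LenPres.nOfFn P, LenPres.nOfFn_mem_FP P, Filter.Eventually.of_forall fun n s hs => ?_⟩⟩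
  · rw [eval_X, hlen n s hs, LenPres.M]; omega
  · rw [LenPres.nOfFn_apply, hlen n s hs, LenPres.nOf_eq le_rfl (LenPres.M_strictMono (Nat.lt_succ_self n)), ones,
      unaryEncodeNat_eq_replicate]

/-- **The tree family over a one-way function is a UOWHF** (Def. 6.4.18, all four conditions).
[cite: Goldreich2004, Thm. 6.4.29] -/
theorem isUOWHF_treeHash2 (hf : IsOneWay f) (hlp : IsLengthPreserving f) (hK : ∀ n, K n ≤ p.eval n) :
    (treeHash2 p f).IsUOWHF (rLenT (tspec2 p f)) := by
  obtain ⟨h1, h2, h3⟩ := tcr_treeHash2 hf hlp hK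
  exact ⟨h1, h2, isAdmissible_of_length_index (P := Polynomial.X * (Pd * p)) fun n s hs => length_index_treeHash2 hs, h3⟩

/-- **Theorem 6.4.29 (Goldreich 2004; Rompel 1990 / Naor–Yung 1989 / Haitner et al. 2020): one-way functions give
universal one-way hash functions** — in the existence form consumed by the hash-and-sign one-time signatures
(`HashAndSignOTSFromUOWHF.lean`): a UOWHF with a polynomial index-coin budget and indices of one polynomial length on each `1ⁿ`.
[cite: Goldreich2004, Thm. 6.4.29] -/
theorem exists_isUOWHF_of_OWFExist (h : OWFExist) :
    ∃ (H : HashCollection) (ℓ' : ℕ → ℕ) (qI pI : Polynomial ℕ), H.IsUOWHF ℓ' ∧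
      (∀ n, H.index.coinLen n = pI.eval n) ∧ ∀ n, ∀ s ∈ (H.indexPMF n).support, s.length = qI.eval n := by
  obtain ⟨f, hf, hlp⟩ := h.exists_isLengthPreserving
  obtain ⟨p, hp⟩ := UExpr.exists_poly_le₁ E.K
  have hK : ∀ n, K n ≤ p.eval n := fun n => by have h := hp n; simp only [E.K_eval] at h; exact h
  refine ⟨treeHash2 p f, rLenT (tspec2 p f), Polynomial.X * (Pd * p) + Polynomial.X + 1, Polynomial.X * (Pd * p),
    isUOWHF_treeHash2 hf hlp hK, fun L => rfl, fun n s hs => ?_⟩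
  rw [length_index_treeHash2 hs, LenPres.M]
  simp only [eval_add, eval_mul, eval_X, eval_one]

end HHRVW

end Literature.Computability.Cryptography
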